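/-
Copyright (c) 2026. All rights reserved.
Released under Apache 2.0 license as described in the file LICENSE.
Authors: abc-iut cell, prover seat abc-iut-w5-d038 (gen 8; PROOF-ONLY: the horoball of a parabolic
element of a uniformising Möbius deck group goes out to ONE puncture — Picard-free, Shimizu route;
row «FC-TOPOLOGICAL» named by abc-iut-w6-d031 g5, steps (S1)–(S2)).
-/
import Literature.AnabelianGeometry.AbsoluteAnabelian.ArchimedeanHolFieldFunctorGeometricPSLFiniteCovolumeCusps
import Literature.AnabelianGeometry.AbsoluteAnabelian.ArchimedeanHolFieldFunctorGeometricPSLCuspParabolicPuncture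
import HarnessLib

/-!
# Horoballs of a parabolic deck transformation go out to one puncture (Shimizu route, PROOF-ONLY)

Classical input for S. Mochizuki, *Topics in Absolute Anabelian Geometry III*, proof of Prop. 4.2 (i)
(p. 106: at the uniformised model `X = ℍ/Λ̄` of a hyperbolic Riemann surface of finite type the group
`N_{PSL₂(ℝ)}(Λ̄)/Λ̄` is finite), in the form abc-iut-L4-d1's
`HolRS.finiteIndex_subgroupOf_normalizer_of_cusps` consumes it: hypothesis (FC) «finitely many
`Λ̄`-classes of cusps».  abc-iut-w6-d031 proved (P) («a puncture is a cusp») for the ABSTRACT Möbius deck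
group of every uniformising `k : ℍ → M ∖ S`; the converse direction — every cusp of `Λ̄` comes from a
puncture — is the «(FC) topological step».  This file does its first half WITHOUT Picard's theorem
(H. Shimizu, Ann. of Math. 77 (1963) Lemma 4; G. Shimura, *Introduction to the Arithmetic Theory of
Automorphic Functions* §1.5; H. M. Farkas, I. Kra, *Riemann Surfaces* IV.5–IV.6):

* (S1) `HolRS.exists_im_smul_le_of_isCompact` — **Shimizu height bound**: for a discrete
  `Γ' ≤ SL(2, ℝ)` (inside `GL(2, ℝ)`) containing the translation `T_h`, `h > 0`, and a compact `K ⊆ ℍ`,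
  the heights `Im (γ • z)`, `γ ∈ Γ'`, `z ∈ K`, are bounded (the tree's Shimizu lemma
  `Fuchsian.one_le_abs_mul_of_mem` `|c| h ≥ 1` and `Fuchsian.eq_upperRightHom_or_neg_of_upperTriangular`);
* (S1′) `HolRS.exists_forall_lt_im_notMem` — for a holomorphic `ℍ`-covering `k` of `X ∈ HolRS` whose
  Möbius deck group `Λ̄` acts properly discontinuously and transitively on the fibres, and `A ∈ SL(2, ℝ)`
  with `π(A T_h A⁻¹) ∈ Λ̄` (`h ≠ 0`; i.e. `A • ∞` is a cusp of `Λ̄`), the horoball images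
  `k (A • {Im τ > C})` leave every compact subset of `X`;
* (S2) ★ `HolRS.exists_tendsto_nhds_puncture` — if moreover `X = U ⊆ M` is the complement of a FINITE
  set in a COMPACT Riemann surface `M`, then `k (A • τ)` CONVERGES in `M` to ONE puncture `s ∈ M ∖ U` as
  `Im τ → ∞` (compactness, `T₂`-separation of the punctures, connectedness of the horoball).

PROOF-ONLY (no definition, no instance, no named fact); MODEL side of [AbsTopIII] §4 (model ≠
reconstruction); classical; nothing here bears on the disputed [IUTchIII] Cor. 3.12.

## References

* S. Mochizuki, *Topics in Absolute Anabelian Geometry III* (2015), proof of Prop. 4.2 (i) p.106.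
  [MochizukiAbsTopIII2015]
* H. Shimizu, *On discontinuous groups operating on the product of the upper half planes*, Ann. of
  Math. 77 (1963), Lemma 4. [Shimizu1963]
* G. Shimura, *Introduction to the Arithmetic Theory of Automorphic Functions* (1971), §1.5. [Shimura1971]
* H. M. Farkas, I. Kra, *Riemann Surfaces*, 2nd ed. (1992), IV.5.5–IV.5.6, IV.6. [FarkasKra1992]
-/

set_option autoImplicit false

noncomputable section

open Complex Filter Topology Metric Set Function
open scoped UpperHalfPlane MatrixGroups Manifold ContDiff Pointwise
open _root_.TopologicalSpace (Opens)
open Matrix.SpecialLinearGroup (toGL)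
open Literature.NumberTheory.Automorphic (IsDiscreteSubgroup)
open Literature.NumberTheory.Automorphic.Fuchsian (translSL rowIm rowDenom)

namespace Literature.AnabelianGeometry.AbsoluteAnabelian

namespace HolRS

/-! ### §1 The Shimizu height bound -/

/-- Points of `ℍ` of arbitrarily large height. [folklore] -/
private theorem exists_lt_im (C : ℝ) : ∃ τ : ℍ, C < τ.im := by
  refine ⟨UpperHalfPlane.mk (((max C 0 + 1 : ℝ) : ℂ) * I) (by simp; positivity), ?_⟩
  rw [UpperHalfPlane.im, UpperHalfPlane.coe_mk]
  simp only [mul_im, ofReal_re, I_im, mul_one, ofReal_im, I_re, mul_zero, add_zero]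
  linarith [le_max_left C 0]

/-- **(S1) Shimizu height bound.**  Let `Γ' ≤ SL(2, ℝ)` (inside `GL(2, ℝ)`) be discrete and contain the
translation `T_h = (1 h; 0 1)`, `h > 0`, and let `K ⊆ ℍ` be compact.  Then the heights `Im (γ • z)`,
`γ ∈ Γ'`, `z ∈ K`, are bounded: for `γ = (a b; c d)` with `c ≠ 0` Shimizu's lemma `|c| h ≥ 1` gives
`Im (γ • z) = Im z / |cz + d|² ≤ 1 / (c² Im z) ≤ h² / Im z`, and for `c = 0` the element is `± T_x`
(no hyperbolic element fixes the cusp `∞` of a discrete group), so `Im (γ • z) = Im z`.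
[cite: Shimizu1963, Lemma 4] [cite: Shimura1971, §1.5] -/
theorem exists_im_smul_le_of_isCompact {Γ' : Subgroup (GL (Fin 2) ℝ)}
    (hΓ' : Γ' ≤ (toGL : SL(2, ℝ) →* GL (Fin 2) ℝ).range) (hd : IsDiscreteSubgroup Γ')
    {h : ℝ} (hh : 0 < h) (hT : Matrix.GeneralLinearGroup.upperRightHom h ∈ Γ')
    {K : Set ℍ} (hK : IsCompact K) :
    ∃ C : ℝ, ∀ γ ∈ Γ', ∀ z ∈ K, (γ • z).im ≤ C := by
  rcases K.eq_empty_or_nonempty with rfl | hne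
  · exact ⟨0, fun γ _ z hz => hz.elim⟩
  -- bounds for the height on `K`
  obtain ⟨zM, -, hzM⟩ := hK.exists_isMaxOn hne UpperHalfPlane.continuous_im.continuousOn
  obtain ⟨zm, -, hzm⟩ := hK.exists_isMinOn hne UpperHalfPlane.continuous_im.continuousOn
  have hm : 0 < zm.im := zm.im_pos
  -- `∞` is a cusp of `Γ'`
  have hinf : IsCusp OnePoint.infty Γ' :=
    Subgroup.isCusp_of_mem_strictPeriods hh (Subgroup.mem_strictPeriods_iff.mpr hT)
  refine ⟨max zM.im (h ^ 2 / zm.im), fun γ hγ z hz => ?_⟩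
  have hzM' : z.im ≤ zM.im := hzM hz
  have hzm' : zm.im ≤ z.im := hzm hz
  have hz0 : 0 < z.im := z.im_pos
  rw [Literature.NumberTheory.Automorphic.Fuchsian.im_smul_eq_rowIm (hΓ' hγ) z, rowIm,
    Literature.NumberTheory.Automorphic.Fuchsian.normSq_rowDenom]
  have e10 : (γ : Matrix (Fin 2) (Fin 2) ℝ) 1 0 = γ 1 0 := rfl
  have e11 : (γ : Matrix (Fin 2) (Fin 2) ℝ) 1 1 = γ 1 1 := rfl
  rw [e10, e11]
  by_cases hc : γ 1 0 = 0
  · -- upper triangular: `γ = ± T_x`, so `d = ± 1`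
    obtain ⟨x, hx⟩ := Literature.NumberTheory.Automorphic.Fuchsian.eq_upperRightHom_or_neg_of_upperTriangular
      hΓ' hd hinf hγ hc
    have hd1 : (γ 1 1) ^ 2 = 1 := by
      rcases hx with rfl | rfl
      · simp [Matrix.GeneralLinearGroup.upperRightHom_apply]
      · rw [show ((-Matrix.GeneralLinearGroup.upperRightHom x : GL (Fin 2) ℝ)) 1 1 =
            -((Matrix.GeneralLinearGroup.upperRightHom x : GL (Fin 2) ℝ) 1 1) from rfl]
        simp [Matrix.GeneralLinearGroup.upperRightHom_apply]
    rw [hc, zero_mul, zero_mul, zero_add, zero_pow two_ne_zero, add_zero, hd1, div_one]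
    exact hzM'.trans (le_max_left _ _)
  · -- `c ≠ 0`: Shimizu `|c| h ≥ 1`
    have hsh : 1 ≤ |γ 1 0| * h :=
      Literature.NumberTheory.Automorphic.Fuchsian.one_le_abs_mul_of_mem hΓ' hd hh hT hγ hc
    have hc2 : 1 ≤ (γ 1 0) ^ 2 * h ^ 2 := by
      have : (|γ 1 0| * h) ^ 2 = (γ 1 0) ^ 2 * h ^ 2 := by rw [mul_pow, sq_abs]
      rw [← this]
      nlinarith
    have hden : (γ 1 0 * z.im) ^ 2 ≤ (γ 1 0 * z.re + γ 1 1) ^ 2 + (γ 1 0 * z.im) ^ 2 := by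
      nlinarith [sq_nonneg (γ 1 0 * z.re + γ 1 1)]
    have hpos : 0 < (γ 1 0 * z.im) ^ 2 := by positivity
    refine le_trans ?_ (le_max_right _ _)
    calc z.im / ((γ 1 0 * z.re + γ 1 1) ^ 2 + (γ 1 0 * z.im) ^ 2)
        ≤ z.im / (γ 1 0 * z.im) ^ 2 := by
          exact div_le_div_of_nonneg_left hz0.le hpos hden
      _ = 1 / ((γ 1 0) ^ 2 * z.im) := by
          field_simp
      _ ≤ h ^ 2 / z.im := by
          rw [div_le_div_iff₀ (by positivity) hz0]
          nlinarith
      _ ≤ h ^ 2 / zm.im := by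
          exact div_le_div_of_nonneg_left (by positivity) hm hzm'

/-! ### §2 Compact subsets of the base are covered by a compact subset of `ℍ` -/

/-- A compact subset of the base of a covering map from `ℍ` (onto a connected base) lies in the image
of a compact subset of `ℍ` (finitely many compact neighbourhoods of chosen preimages; the covering map
is open). [cite: FarkasKra1992, IV.5.5–IV.5.6] -/
theorem exists_isCompact_subset_image (X : HolRS) {k : ℍ → X.carrier} (hk : IsCoveringMap k)
    {K : Set X.carrier} (hK : IsCompact K) :
    ∃ K' : Set ℍ, IsCompact K' ∧ K ⊆ k '' K' := by
  classical
  haveI : Nonempty ℍ := ⟨UpperHalfPlane.I⟩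
  have hsurj : Surjective k := hk.surjective_of_connectedSpace'
  have hopen : IsOpenMap k := hk.isLocalHomeomorph.isOpenMap
  choose τ hτ using hsurj
  have hN : ∀ y : X.carrier, ∃ N : Set ℍ, IsCompact N ∧ N ∈ 𝓝 (τ y) := fun y =>
    exists_compact_mem_nhds (τ y)
  choose N hNc hNn using hN
  have hcover : ∀ y ∈ K, k '' N y ∈ 𝓝 y := by
    intro y _
    have h1 : k '' interior (N y) ⊆ k '' N y := image_mono interior_subset
    refine Filter.mem_of_superset ?_ h1
    refine (hopen _ isOpen_interior).mem_nhds ?_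
    exact ⟨τ y, mem_interior_iff_mem_nhds.mpr (hNn y), hτ y⟩
  obtain ⟨t, -, hKt⟩ := hK.elim_nhds_subcover (fun y => k '' N y) fun y hy => hcover y hy
  refine ⟨⋃ y ∈ t, N y, t.isCompact_biUnion fun y _ => hNc _, fun x hx => ?_⟩
  obtain ⟨y, hy, hxy⟩ : ∃ y ∈ t, x ∈ k '' N y := by
    simpa only [mem_iUnion, exists_prop] using hKt hx
  obtain ⟨z, hz, rfl⟩ := hxy
  exact ⟨z, mem_iUnion₂.mpr ⟨y, hy, hz⟩, rfl⟩

/-! ### §3 Horoball images leave every compact subset of the base -/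

/-- `toGL (A T_h A⁻¹) = toGL A · upperRightHom h · (toGL A)⁻¹`. [folklore] -/
private theorem toGL_conj_translSL (A : SL(2, ℝ)) (h : ℝ) :
    (toGL (A * translSL h * A⁻¹) : GL (Fin 2) ℝ) =
      toGL A * Matrix.GeneralLinearGroup.upperRightHom h * (toGL A)⁻¹ := by
  rw [map_mul, map_mul, map_inv, Literature.NumberTheory.Automorphic.Fuchsian.toGL_translSL]

/-- **(S1′) Horoball images leave every compact.**  Let `k : ℍ → X` be a covering map of `X ∈ HolRS`
whose Möbius deck group `Λ̄ ≤ PSL₂(ℝ)` acts properly discontinuously on `ℍ` and transitively on the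
fibres of `k`, and let `A ∈ SL(2, ℝ)`, `h ≠ 0` with `π(A T_h A⁻¹) ∈ Λ̄` (a parabolic element of `Λ̄`
with fixed point `A • ∞`).  Then for every compact `K ⊆ X` there is `C` with `k (A • τ) ∉ K` whenever
`Im τ > C`: a point `A • τ` over `K` is `g • z` with `π g ∈ Λ̄`, `z` in a fixed compact, and then
`Im τ = Im ((A⁻¹ g A) • (A⁻¹ • z))` is bounded by (S1) for the discrete group `A⁻¹ (π⁻¹Λ̄) A ∋ T_{|h|}`.
[cite: Shimura1971, §1.5] [cite: FarkasKra1992, IV.5.5–IV.5.6] -/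
theorem exists_forall_lt_im_notMem (X : HolRS) {k : ℍ → X.carrier} (hk : IsCoveringMap k)
    (Λ : Subgroup PSL2R) [ProperlyDiscontinuousSMul Λ ℍ]
    (hfib : ∀ τ τ' : ℍ, k τ = k τ' → ∃ q ∈ Λ, q • τ = τ')
    (A : SL(2, ℝ)) {h : ℝ} (hh : h ≠ 0)
    (hT : (QuotientGroup.mk' (Subgroup.center SL(2, ℝ)) (A * translSL h * A⁻¹) : PSL2R) ∈ Λ)
    {K : Set X.carrier} (hK : IsCompact K) :
    ∃ C : ℝ, ∀ τ : ℍ, C < τ.im → k (A • τ) ∉ K := by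
  classical
  obtain ⟨K', hK', hKK'⟩ := exists_isCompact_subset_image X hk hK
  -- the lifted deck group and its conjugate by `A⁻¹`
  let π : SL(2, ℝ) →* PSL2R := QuotientGroup.mk' (Subgroup.center SL(2, ℝ))
  set G : Subgroup (GL (Fin 2) ℝ) := (Λ.comap π).map (toGL : SL(2, ℝ) →* GL (Fin 2) ℝ) with hG
  have hGd : IsDiscreteSubgroup G := isDiscreteSubgroup_map_toGL_comap Λ
  have hGr : G ≤ (toGL : SL(2, ℝ) →* GL (Fin 2) ℝ).range := map_toGL_comap_le_range Λ
  set Γ' : Subgroup (GL (Fin 2) ℝ) := ConjAct.toConjAct (toGL A⁻¹ : GL (Fin 2) ℝ) • G with hΓ'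
  have hΓ'd : IsDiscreteSubgroup Γ' := hGd.conj _
  have hΓ'r : Γ' ≤ (toGL : SL(2, ℝ) →* GL (Fin 2) ℝ).range :=
    Literature.NumberTheory.Automorphic.Fuchsian.conj_le_range hGr A⁻¹
  have hmemΓ' : ∀ δ : GL (Fin 2) ℝ, δ ∈ Γ' ↔ (toGL A : GL (Fin 2) ℝ) * δ * (toGL A)⁻¹ ∈ G := by
    intro δ
    rw [hΓ', map_inv]
    exact Literature.NumberTheory.Automorphic.Fuchsian.mem_conj_inv_iff _ _
  have hmemG : ∀ g : SL(2, ℝ), (toGL g : GL (Fin 2) ℝ) ∈ G ↔ (π g : PSL2R) ∈ Λ := by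
    intro g
    rw [hG]
    constructor
    · rintro ⟨g', hg', hgg'⟩
      have : g' = g := Matrix.SpecialLinearGroup.toGL_injective hgg'
      subst this
      exact hg'
    · intro hg
      exact ⟨g, hg, rfl⟩
  -- the translation `T_{|h|}` lies in `Γ'`
  have hTG : (toGL A : GL (Fin 2) ℝ) * Matrix.GeneralLinearGroup.upperRightHom h * (toGL A)⁻¹ ∈ G := by
    rw [← toGL_conj_translSL, hmemG]
    exact hT
  have hT' : Matrix.GeneralLinearGroup.upperRightHom |h| ∈ Γ' := by
    rw [hmemΓ']
    rcases lt_or_gt_of_ne hh with hneg | hpos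
    · rw [abs_of_neg hneg, AddChar.map_neg_eq_inv]
      have : (toGL A : GL (Fin 2) ℝ) * (Matrix.GeneralLinearGroup.upperRightHom h)⁻¹ * (toGL A)⁻¹ =
          ((toGL A : GL (Fin 2) ℝ) * Matrix.GeneralLinearGroup.upperRightHom h * (toGL A)⁻¹)⁻¹ := by
        group
      rw [this]
      exact G.inv_mem hTG
    · rw [abs_of_pos hpos]
      exact hTG
  -- the height bound on the compact `A⁻¹ • K'`
  have hK'' : IsCompact ((fun z : ℍ => A⁻¹ • z) '' K') := hK'.image (continuous_const_smul _)
  obtain ⟨C, hC⟩ := exists_im_smul_le_of_isCompact hΓ'r hΓ'd (abs_pos.mpr hh) hT' hK''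
  refine ⟨C, fun τ hτ hmem => ?_⟩
  -- a point of the horoball over `K` contradicts the bound
  obtain ⟨z, hz, hkz⟩ := hKK' hmem
  obtain ⟨q, hq, hqz⟩ := hfib z (A • τ) hkz
  obtain ⟨g, rfl⟩ := QuotientGroup.mk_surjective q
  have hgz : g • z = A • τ := by rw [← psl_mk_smul]; exact hqz
  have hγ : (toGL (A⁻¹ * g * A) : GL (Fin 2) ℝ) ∈ Γ' := by
    rw [hmemΓ', ← map_inv, ← map_mul, ← map_mul, hmemG]
    have : A * (A⁻¹ * g * A) * A⁻¹ = g := by group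
    rw [this]
    exact hq
  have hτ' : τ = (A⁻¹ * g * A) • (A⁻¹ • z) := by
    rw [mul_smul, smul_inv_smul, mul_smul, hgz, inv_smul_smul]
  have hle := hC _ hγ (A⁻¹ • z) (mem_image_of_mem _ hz)
  rw [← sl_smul_eq_toGL_smul, ← hτ'] at hle
  exact (not_lt.mpr hle) hτ

/-! ### §4 Convergence to one puncture -/

section Puncture

variable {M : Type} [TopologicalSpace M] [T2Space M] [CompactSpace M] [ChartedSpace ℂ M]
  [IsManifold 𝓘(ℂ, ℂ) ω M]

/-- The horoball `{Im τ > C} ⊆ ℍ` is preconnected (a convex half-plane). [folklore] -/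
private theorem isPreconnected_setOf_lt_im (C : ℝ) : IsPreconnected {τ : ℍ | C < τ.im} := by
  rw [← UpperHalfPlane.isEmbedding_coe.isInducing.isPreconnected_image]
  have : ((↑) : ℍ → ℂ) '' {τ : ℍ | C < τ.im} = {w : ℂ | max C 0 < w.im} := by
    ext w
    constructor
    · rintro ⟨τ, hτ, rfl⟩
      exact max_lt hτ τ.im_pos
    · intro hw
      have hw' : max C 0 < w.im := hw
      refine ⟨UpperHalfPlane.mk w (lt_of_le_of_lt (le_max_right _ _) hw'), ?_, rfl⟩
      exact lt_of_le_of_lt (le_max_left _ _) hw'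
  rw [this]
  exact (convex_halfSpace_im_gt _).isPreconnected

/-- The selection step of (S2): for pairwise disjoint open neighbourhoods `W x ∋ x` of the punctures,
deep horoball images lie in ONE `W s`, `s` a puncture. [cite: FarkasKra1992, IV.5.5–IV.5.6] -/
theorem exists_forall_lt_im_mem_nhd (U : Opens M) (hU : IsConnected (U : Set M))
    {k : ℍ → (ofOpens U hU).carrier} (hk : IsCoveringMap k)
    (Λ : Subgroup PSL2R) [ProperlyDiscontinuousSMul Λ ℍ]
    (hfib : ∀ τ τ' : ℍ, k τ = k τ' → ∃ q ∈ Λ, q • τ = τ')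
    (A : SL(2, ℝ)) {h : ℝ} (hh : h ≠ 0)
    (hT : (QuotientGroup.mk' (Subgroup.center SL(2, ℝ)) (A * translSL h * A⁻¹) : PSL2R) ∈ Λ)
    (W : M → Set M) (hW : ∀ x, x ∈ W x ∧ IsOpen (W x)) (hWd : ((U : Set M)ᶜ).PairwiseDisjoint W) :
    ∃ C : ℝ, ∃ s ∈ (U : Set M)ᶜ, ∀ τ : ℍ, C < τ.im → (k (A • τ)).1 ∈ W s := by
  classical
  -- the compact complement of the neighbourhoods, inside `U`
  set KM : Set M := (⋃ x ∈ (U : Set M)ᶜ, W x)ᶜ with hKM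
  have hKMc : IsCompact KM := by
    refine (IsOpen.isClosed_compl ?_).isCompact
    exact isOpen_biUnion fun x _ => (hW x).2
  have hKMU : KM ⊆ (U : Set M) := by
    intro y hy
    by_contra hyU
    exact hy (mem_iUnion₂.mpr ⟨y, hyU, (hW y).1⟩)
  set K : Set ↥U := Subtype.val ⁻¹' KM with hKdef
  have hKc : IsCompact K := by
    have hr : KM ⊆ range (Subtype.val : ↥U → M) := fun y hy => ⟨⟨y, hKMU hy⟩, rfl⟩
    rw [hKdef, Topology.IsEmbedding.subtypeVal.isCompact_iff, image_preimage_eq_of_subset hr]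
    exact hKMc
  obtain ⟨C, hC⟩ := exists_forall_lt_im_notMem (ofOpens U hU) hk Λ hfib A hh hT (K := K) hKc
  -- deep points lie in `⋃ W x`
  have hmemU : ∀ τ : ℍ, C < τ.im → (k (A • τ)).1 ∈ ⋃ x ∈ (U : Set M)ᶜ, W x := by
    intro τ hτ
    have h1 : (k (A • τ)).1 ∉ KM := hC τ hτ
    rw [hKM, mem_compl_iff, not_not] at h1
    exact h1
  -- one deep point and its neighbourhood
  obtain ⟨τ₀, hτ₀⟩ := exists_lt_im C
  obtain ⟨s, hsS, hs⟩ : ∃ s ∈ (U : Set M)ᶜ, (k (A • τ₀)).1 ∈ W s := by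
    simpa only [mem_iUnion, exists_prop] using hmemU τ₀ hτ₀
  refine ⟨C, s, hsS, ?_⟩
  -- connectedness: the whole horoball image lies in `W s`
  let f : ℍ → M := fun τ => (k (A • τ)).1
  have hf : Continuous f := by
    have h1 : Continuous fun τ : ℍ => k (A • τ) := hk.continuous.comp (continuous_const_smul A)
    exact continuous_subtype_val.comp h1
  have hpre : IsPreconnected (f '' {τ : ℍ | C < τ.im}) :=
    (isPreconnected_setOf_lt_im C).image f hf.continuousOn
  have hsub : f '' {τ : ℍ | C < τ.im} ⊆ W s ∪ ⋃ x ∈ (U : Set M)ᶜ \ {s}, W x := by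
    rintro _ ⟨τ, hτ, rfl⟩
    obtain ⟨x, hxS, hx⟩ : ∃ x ∈ (U : Set M)ᶜ, f τ ∈ W x := by
      simpa only [mem_iUnion, exists_prop] using hmemU τ hτ
    by_cases hxs : x = s
    · exact Or.inl (hxs ▸ hx)
    · exact Or.inr (mem_iUnion₂.mpr ⟨x, ⟨hxS, hxs⟩, hx⟩)
  have hdisj : Disjoint (W s) (⋃ x ∈ (U : Set M)ᶜ \ {s}, W x) := by
    rw [disjoint_iUnion₂_right]
    rintro x ⟨hxS, hxs⟩
    exact hWd hsS hxS (Ne.symm hxs)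
  have hopen2 : IsOpen (⋃ x ∈ (U : Set M)ᶜ \ {s}, W x) := isOpen_biUnion fun x _ => (hW x).2
  have hall := hpre.subset_left_of_subset_union (hW s).2 hopen2 hdisj hsub
    ⟨f τ₀, mem_image_of_mem f hτ₀, hs⟩
  intro τ hτ
  exact hall (mem_image_of_mem f hτ)

/-- ★ **(S2) The horoball of a cusp goes out to ONE puncture.**  Let `M` be a COMPACT Riemann surface,
`U ⊆ M` a connected open subset with FINITE complement `S`, `k : ℍ → U` a covering map whose Möbius deck
group `Λ̄ ≤ PSL₂(ℝ)` acts properly discontinuously on `ℍ` and transitively on the fibres, and let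
`A ∈ SL(2, ℝ)`, `h ≠ 0` with `π(A T_h A⁻¹) ∈ Λ̄` (so `A • ∞` is a cusp of `Λ̄`).  Then there is a puncture
`s ∈ S` with `k (A • τ) → s` in `M` as `Im τ → ∞`: the horoball leaves every compact of `U` (S1′), the
punctures have pairwise disjoint neighbourhoods whose complement is compact, and the image of the
connected horoball selects one of them — the same one for every finer system of neighbourhoods.
[cite: FarkasKra1992, IV.5.5–IV.5.6] [cite: MochizukiAbsTopIII2015, Proposition 4.2 (i) proof p.106] -/
theorem exists_tendsto_nhds_puncture (U : Opens M) (hU : IsConnected (U : Set M))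
    (hS : ((U : Set M)ᶜ).Finite) {k : ℍ → (ofOpens U hU).carrier} (hk : IsCoveringMap k)
    (Λ : Subgroup PSL2R) [ProperlyDiscontinuousSMul Λ ℍ]
    (hfib : ∀ τ τ' : ℍ, k τ = k τ' → ∃ q ∈ Λ, q • τ = τ')
    (A : SL(2, ℝ)) {h : ℝ} (hh : h ≠ 0)
    (hT : (QuotientGroup.mk' (Subgroup.center SL(2, ℝ)) (A * translSL h * A⁻¹) : PSL2R) ∈ Λ) :
    ∃ s ∈ (U : Set M)ᶜ,
      Tendsto (fun τ : ℍ => (k (A • τ)).1) (comap UpperHalfPlane.im atTop) (𝓝 s) := by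
  classical
  -- pairwise disjoint open neighbourhoods of the punctures
  obtain ⟨W, hW, hWd⟩ := hS.t2_separation
  obtain ⟨C, s, hsS, hs⟩ := exists_forall_lt_im_mem_nhd U hU hk Λ hfib A hh hT W hW hWd
  refine ⟨s, hsS, ?_⟩
  rw [(nhds_basis_opens s).tendsto_right_iff]
  rintro V ⟨hsV, hV⟩
  -- refine the neighbourhood of `s` to `W s ∩ V`
  let W' : M → Set M := fun x => if x = s then W s ∩ V else W x
  have hW' : ∀ x, x ∈ W' x ∧ IsOpen (W' x) := by
    intro x
    by_cases hxs : x = s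
    · subst hxs
      simp only [W', if_true]
      exact ⟨⟨(hW x).1, hsV⟩, (hW x).2.inter hV⟩
    · simp only [W', if_neg hxs]
      exact hW x
  have hW'le : ∀ x, W' x ⊆ W x := by
    intro x
    by_cases hxs : x = s
    · subst hxs; simp only [W', if_true]; exact inter_subset_left
    · simp only [W', if_neg hxs]; exact Subset.rfl
  have hW'd : ((U : Set M)ᶜ).PairwiseDisjoint W' :=
    hWd.mono fun x => hW'le x
  obtain ⟨C', s', hs'S, hs'⟩ := exists_forall_lt_im_mem_nhd U hU hk Λ hfib A hh hT W' hW' hW'd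
  -- the refined selection is again `s`
  have hss' : s' = s := by
    obtain ⟨τ, hτ⟩ := exists_lt_im (max C C')
    have h1 : (k (A • τ)).1 ∈ W s := hs τ (lt_of_le_of_lt (le_max_left _ _) hτ)
    have h2 : (k (A • τ)).1 ∈ W s' := hW'le s' (hs' τ (lt_of_le_of_lt (le_max_right _ _) hτ))
    by_contra hne
    exact (hWd hsS hs'S (Ne.symm hne)).le_bot ⟨h1, h2⟩
  subst hss'
  -- eventually in `V`
  rw [eventually_comap]
  filter_upwards [eventually_gt_atTop C'] with b hb τ hτ
  have := hs' τ (hτ ▸ hb)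
  simp only [W', if_true] at this
  exact this.2

end Puncture

end HolRS

end Literature.AnabelianGeometry.AbsoluteAnabelian

end
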